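import Summits.ResolutionOfSingularities.ResolutionOfSingularities.Theorems.EquisingularLiftEquisingularLiftNatShadowLocalTransport
import HarnessLib

/-!
# [OURS · L1 W4.5(b) · EL♮(3)] Rung TOWER₄ — A POINT STEP WITH ANY CENTRE OVER ONE SPECIAL POINT ON `Tower.Inv₃` (LOCALIZED SHADOW TRACE
# (k-ii-loc), res-D-pv-029 …NatTowerInvDefs v3 p570397): centre-agnostic new-plane / transport / forget lemmas, shared by (pt-reg) and (pt-ram)
# (crux `EquisingularLiftNatThree` = stmt-ResolutionOfSingularities-20148, parent stmt-…-20038; registered stub `stub_elnat_coneTowerPointResolution` @ `ReachTower₄`)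

HONEST FRAMING. OURS (cell res-hironaka, crux chain w45b, slot W4.5(b)); NOT a statement of any manuscript; AI-written, weaker than expert
review. Helper `--supports stmt-ResolutionOfSingularities-20148 --as helper`; closes nothing; no `sorry`; standard axioms; DEF-FREE.
res-L1-w45b-stub-4 g8, object (R-a) of res-D-pv-029's retarget list (STATUS 2026-08-27T20:58:53Z / DECISION 20:53:20Z «LOCALIZE THE SHADOW TRACK»,
after res-type-100's S7 finding 20:46:11Z): the twin of …NatTowerInvTwoPointCentre (p558073) at `Tower.Inv₃`, whose cone-shadow clause (k-ii) is
now only an equality of ideal sheaves RESTRICTED to an open `V ⊇ E`: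
  `(k-ii-loc) ∃ V : G.Opens, E ⊆ V ∧ (𝒦.comap jG).comap V.ι = 𝓘⟨closure K⟩.comap V.ι`.

WHAT CHANGES (honestly): with (k-ii) only local, «`jG pt ∉ supp 𝒦`» is no longer derivable for a step point `pt ∉ V ∪ closure K` (the cone may
have components away from the carrier point — exactly res-type-100's finding), so the cone `V(𝒦)` MAY MEET the upstairs centre `C` and the
off-centre package `fatPointStep_transport … 𝒦` (disjointness, `V(𝒦·𝒪_{X″}) ≅ V(𝒦)`) is unavailable for `𝒦`. Clause by clause for
`𝒦′ := 𝒦·𝒪_{X″}`: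
* (k-i) `isPrincipal_stalkIdeal_comap` (pull back a generator);
* (k-ii-loc) on `V′ := υ₂⁻¹V`: `comap_comap_comap_ι_eq_of_loc` — restrict the model square to `V`, use the local trace there, and the DOWNSTAIRS fact
  `𝓘⟨closure K⟩·𝒪_{G′} = 𝓘⟨υ₂⁻¹ closure K⟩ = 𝓘⟨closure υ₂⁻¹(K ∖ pt)⟩` (`IsBlowup.comap_vanishingIdeal_of_disjoint`, `pt ∉ closure K`);
* (k-iii) flatness and (k-vi) through `V((𝓔 ⊔ 𝒦)·𝒪_{X″}) ≅ V(𝓔 ⊔ 𝒦)` / `V(𝓔·𝒪_{X″}) ≅ V(𝓔)` — these only need `supp 𝓔 ∩ supp C = ∅`, which (e-i)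
  (still GLOBAL) and `pt ∉ E` give;
* (k-iv) `Tower.shadow_conditionalRegularity_transport_loc`: a point `y₂` over `supp(𝓔′ ⊔ 𝒦′)` lies over `E ⊆ V`, where the local trace gives
  `υ₂ y₂ ∈ closure K`; the quotient stalks are compared through the stalk isomorphism of `τ` off its centre (no strict transform needed);
* (k-v) `isEffectiveCartier_comap_comap_subschemeι_of_disjoint_left`: BY LOCALITY on `V(𝒦′)` — off `supp 𝓔′` the divisor is the unit ideal
  (`mem_cartierLocus_of_not_mem_support`), over `supp 𝓔′` the blow-up is a local isomorphism and the Cartier DATUM of …NatCarrierCutsConeStep transports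
  (`datum_of_mem_cartierLocus_subschemeι`, `datum_strictTransform_of_not_mem_support`, `mem_cartierLocus_subschemeι_of_datum`).
RESULTS: `Tower.inv₃_pointCentre_new` / `_transport` / `_forget` with the binders of the `Inv₂` versions VERBATIM except `Tower.Exc₃` for `Tower.Exc₂`
(tools in …NatShadowLocalTransport).

References: res-D-pv-029 …NatTowerInvDefs v3 p570397; res-L1-w45b-stub-4 …NatTowerInvTwoPointCentre p558073, …NatTowerPtRamInv p555772,
…NatBlowupDisjointTransport p550227, …NatCarrierCutsConeStep p557314; Literature `EffectiveCartierStalks` (Cartier locus), `MonomialMarkedIdealsBlowup`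
(`stalkIdeal_strictTransformIdeal_of_not_mem_support`). [cite: GortzWedhorn2020, Prop. 13.91 (3) and (13.19)] [cite: StacksProject, Tags 01WS, 02OS, 033B]
-/

set_option linter.dupNamespace false -- mandated namespace `Summit.<Summit>.<Problem>` of this single-conjunct summit

noncomputable section

open CategoryTheory CategoryTheory.Limits AlgebraicGeometry TopologicalSpace Topology IsLocalRing
open Literature.AlgebraicGeometry.Resolution
open AlgebraicGeometry.Scheme.IdealSheafData
open Summit.ResolutionOfSingularities.ResolutionOfSingularities.Theses.EquisingularLift.Split
open scoped nonZeroDivisors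

namespace Summit.ResolutionOfSingularities.ResolutionOfSingularities.Cruxes.EquisingularLiftNat.Sections

/-! ## The point step on `Tower.Inv₃` -/

section PointCentre

variable (O : Type) [CommRing O] (k : Type) [Field k] (θ : O →+* k) (P : Scheme.{0}) (q : P ⟶ Spec (.of O)) (Y : Set P)
  (Ch : ∀ X' : Scheme.{0}, (X' ⟶ P) → Set X' → Prop) (Ruled : Tower.RuledDatum P)
  {F₉ : Scheme.{0}} {Z₉ : Set F₉} {hZ₉ : IsClosed Z₉} {F₁₀ : Scheme.{0}} {υ' : F₁₀ ⟶ F₉}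
  {G G' X X'' : Scheme.{0}} {γ : G ⟶ F₁₀} {T E K : Set G}
  -- context and downstairs bookkeeping of the old invariant
  (hυ' : IsBlowup υ' (vanishingIdeal (⟨Z₉, hZ₉⟩ : Closeds F₉))) (hZ₉inf : Z₉.Infinite)
  (hTirr : IsIrreducible T) (hEcl : IsClosed E) (hTE : ¬ T ⊆ E)
  -- the old stage and its exceptional / shadow datum, LOCALIZED trace
  {σ : X ⟶ P} {jG : G ⟶ X}
  (hExc : ∀ hE : IsClosed E, Tower.Exc₃ O P q Y Ruled Z₉ hZ₉ υ' G γ E hE K X σ jG)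
  -- the point, the downstairs centre and its blow-up
  {pt : G} (hyc : IsClosed ({pt} : Set G)) (hTy : ¬ T ⊆ {pt}) {D : G.IdealSheafData} (hD : (D.support : Set G) = {pt})
  {υ₂ : G' ⟶ G} (hυ₂ : IsBlowup υ₂ D) [IsLocallyNoetherian G] [IsLocallyNoetherian X] [IsLocallyNoetherian X'']
  -- the upstairs blow-up: any centre missing every closed subscheme not through `jG pt`
  {τ : X'' ⟶ X} {C : X.IdealSheafData} (hτ : IsBlowup τ C)
  (hdisj : ∀ I : X.IdealSheafData, jG pt ∉ (I.support : Set X) → Disjoint (I.support : Set X) (C.support : Set X))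
  -- the model square and the new stage
  {j₂ : G' ⟶ X''} {t₂ : G' ⟶ Spec (.of k)} (hcomm : j₂ ≫ τ = υ₂ ≫ jG)
  {S'' : Set X''} (hCh'' : Ch X'' (τ ≫ σ) S'') [IsIntegral X''] (hX''reg : Scheme.IsRegular X'') (hdom'' : IsDominant ((τ ≫ σ) ≫ q))
  (hsq₂ : IsPullback j₂ t₂ ((τ ≫ σ) ≫ q) (Spec.map (CommRingCat.ofHom θ)))
  (hsets : j₂ '' closure (υ₂ ⁻¹' (T \ {pt})) = S'') [IsIntegral G'] (hT'irr : IsIrreducible (closure (υ₂ ⁻¹' (T \ {pt}))))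

include hυ' hZ₉inf hyc hTy hD hυ₂ hCh'' hX''reg hdom'' hsq₂ hsets hT'irr

omit [IsLocallyNoetherian X] in
/-- **A point step on `Tower.Inv₃`, NEW PLANE `E ↦ υ₂⁻¹{pt}`** — for ANY new shadow `K′`: the new plane hosts no round. Centre-agnostic;
verbatim the `Inv₂` lemma. [cite: Liu2002, §8.1 and Thm. 8.1.19] [OURS · L1 W4.5b · (R-a)] toward `stub_elnat_coneTowerPointResolution`
(stmt-ResolutionOfSingularities-20148 / -20038); NOT a statement of the manuscript. -/
theorem Tower.inv₃_pointCentre_new (K' : Set G') :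
    Tower.Inv₃ O k θ P q Y Ch Ruled F₉ Z₉ hZ₉ F₁₀ υ' G' (υ₂ ≫ γ) (closure (υ₂ ⁻¹' (T \ {pt}))) (υ₂ ⁻¹' {pt}) K' := by
  -- `T′ ⊄ υ₂⁻¹{pt}`: a point of `T` other than `pt` lifts
  have hTE' : ¬ closure (υ₂ ⁻¹' (T \ {pt})) ⊆ υ₂ ⁻¹' {pt} := by
    obtain ⟨t, htT, htne⟩ := Set.not_subset.mp hTy
    have htJ : t ∉ (D.support : Set G) := by rw [hD]; exact htne
    obtain ⟨t₂, ht₂⟩ := exists_preimage_of_not_mem_support υ₂ D hυ₂ htJ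
    intro hsub
    have h1 : t₂ ∈ closure (υ₂ ⁻¹' (T \ {pt})) := subset_closure (by rw [Set.mem_preimage, ht₂]; exact ⟨htT, htne⟩)
    have h2 := hsub h1
    rw [Set.mem_preimage, ht₂] at h2
    exact htne h2
  refine ⟨hυ', hZ₉inf, inferInstance, isClosed_closure, hT'irr, hyc.preimage υ₂.continuous, hTE', X'', τ ≫ σ, _, j₂, t₂, hCh'',
    inferInstance, inferInstance, hX''reg, hdom'', hsq₂, hsets, fun _ => Or.inl ?_⟩
  refine (Set.finite_singleton ((γ ≫ υ') pt)).subset ?_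
  rintro _ ⟨z, hz, rfl⟩
  rw [Set.mem_preimage, Set.mem_singleton_iff] at hz
  rw [Set.mem_singleton_iff, Scheme.Hom.comp_apply, Scheme.Hom.comp_apply, Scheme.Hom.comp_apply, hz]

include hTirr hEcl hTE hExc hdisj hcomm hτ in
/-- **A point step on `Tower.Inv₃`, TRANSPORTED SURFACE `E ↦ closure υ₂⁻¹(E∖{pt})`, SHADOW CARRIED `K ↦ closure υ₂⁻¹(K∖{pt})`** — under
«`E` hosts no round ∨ `pt ∉ E`», «`K = ∅ ∨ pt ∉ closure K`» and the ruled-datum transport hypothesis `hRuled` (interface `ruled_of_step_away`):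
`𝓔, 𝒦 ↦ ·.comap τ`; the cone MAY meet the centre (see the module docstring): (k-i) by pulling back generators, (k-ii-loc) on `υ₂⁻¹V`,
(k-iii)/(k-vi) through the isomorphisms over `supp 𝓔`, (k-iv) by `Tower.shadow_conditionalRegularity_transport_loc`, (k-v) by locality.
[cite: GortzWedhorn2020, Prop. 13.91 (3) and (13.19)] [cite: StacksProject, Tags 01WS, 033B] [OURS · L1 W4.5b · (R-a)] toward
`stub_elnat_coneTowerPointResolution`; NOT a statement of the manuscript. -/
theorem Tower.inv₃_pointCentre_transport
    (hRuled : ∀ (G₀ G₀' : Scheme.{0}) (γ₀ : G₀ ⟶ F₁₀) (E₀ : Set G₀) (X₀ X₀'' : Scheme.{0}) (σ₀ : X₀ ⟶ P) (j₀ : G₀ ⟶ X₀)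
        (j₀' : G₀' ⟶ X₀'') (t₀' : G₀' ⟶ Spec (.of k)) (𝓔₀ : X₀.IdealSheafData) (τ₀ : X₀'' ⟶ X₀) (υ₀ : G₀' ⟶ G₀) (y₀ : G₀),
      j₀' ≫ τ₀ = υ₀ ≫ j₀ → IsPullback j₀' t₀' ((τ₀ ≫ σ₀) ≫ q) (Spec.map (CommRingCat.ofHom θ)) → y₀ ∉ E₀ →
      (∃ e : (𝓔₀.comap τ₀).subscheme ≅ 𝓔₀.subscheme, e.hom ≫ 𝓔₀.subschemeι = (𝓔₀.comap τ₀).subschemeι ≫ τ₀) →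
      Ruled F₉ Z₉ hZ₉ F₁₀ υ' G₀ γ₀ E₀ X₀ σ₀ j₀ 𝓔₀ →
      Ruled F₉ Z₉ hZ₉ F₁₀ υ' G₀' (υ₀ ≫ γ₀) (closure (υ₀ ⁻¹' (E₀ \ {y₀}))) X₀'' (τ₀ ≫ σ₀) j₀' (𝓔₀.comap τ₀))
    (hE : Tower.NoRound υ' G γ E ∨ pt ∉ E) (hK : K = ∅ ∨ pt ∉ closure K) :
    Tower.Inv₃ O k θ P q Y Ch Ruled F₉ Z₉ hZ₉ F₁₀ υ' G' (υ₂ ≫ γ) (closure (υ₂ ⁻¹' (T \ {pt})))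
      (closure (υ₂ ⁻¹' (E \ {pt}))) (closure (υ₂ ⁻¹' (K \ {pt}))) := by
  -- `T′ ⊄ E′`: a point of `T` off `E` and other than `pt` lifts
  have hE'sub : closure (υ₂ ⁻¹' (E \ {pt})) ⊆ υ₂ ⁻¹' E :=
    closure_minimal (fun z hz => hz.1) (hEcl.preimage υ₂.continuous)
  have hTE' : ¬ closure (υ₂ ⁻¹' (T \ {pt})) ⊆ closure (υ₂ ⁻¹' (E \ {pt})) := by
    have hex : ∃ t ∈ T, t ∉ E ∧ t ≠ pt := by
      by_contra hcon
      push Not at hcon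
      have hsub : T ⊆ E ∪ {pt} := fun t ht => by
        by_cases h : t ∈ E
        · exact Or.inl h
        · exact Or.inr (hcon t ht h)
      rcases (isPreirreducible_iff_isClosed_union_isClosed.mp hTirr.isPreirreducible) _ _ hEcl hyc hsub with h | h
      · exact hTE h
      · exact hTy h
    obtain ⟨t, htT, htE, htne⟩ := hex
    have htJ : t ∉ (D.support : Set G) := by rw [hD]; exact htne
    obtain ⟨t₂, ht₂⟩ := exists_preimage_of_not_mem_support υ₂ D hυ₂ htJ
    intro hsub
    have h1 : t₂ ∈ closure (υ₂ ⁻¹' (T \ {pt})) := subset_closure (by rw [Set.mem_preimage, ht₂]; exact ⟨htT, htne⟩)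
    have h2 := hE'sub (hsub h1)
    rw [Set.mem_preimage, ht₂] at h2
    exact htE h2
  -- `NoRound` persists
  have hNR : Tower.NoRound υ' G γ E → Tower.NoRound υ' G' (υ₂ ≫ γ) (closure (υ₂ ⁻¹' (E \ {pt}))) := by
    intro hno
    refine hno.subset ?_
    rintro _ ⟨z, hz, rfl⟩
    exact ⟨υ₂ z, hE'sub hz, by rw [Scheme.Hom.comp_apply, Scheme.Hom.comp_apply, Scheme.Hom.comp_apply]⟩
  refine ⟨hυ', hZ₉inf, inferInstance, isClosed_closure, hT'irr, isClosed_closure, hTE', X'', τ ≫ σ, _, j₂, t₂, hCh'',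
    inferInstance, inferInstance, hX''reg, hdom'', hsq₂, hsets, fun hE' => ?_⟩
  rcases hE with hno | hyE
  · exact Or.inl (hNR hno)
  rcases hExc hEcl with hno | ⟨𝓔, he1, he2, he3, he4, he5, hSh⟩
  · exact Or.inl (hNR hno)
  -- the round-ready branch: transport `𝓔` (its trace is global, so it misses the centre)
  have he1' : 𝓔.comap jG = vanishingIdeal (⟨closure E, isClosed_closure⟩ : Closeds G) := by
    rw [he1]; congr 1; exact Closeds.ext hEcl.closure_eq.symm
  have hyE' : pt ∉ closure E := by rwa [hEcl.closure_eq]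
  obtain ⟨hd𝓔, he, -, hregT, hprinc, htrace⟩ := fatPointStep_transport hτ hcomm hυ₂ hD hdisj 𝓔 E he1' hyE'
  obtain ⟨e𝓔, he𝓔⟩ := he
  refine Or.inr ⟨𝓔.comap τ, htrace, fun z => hprinc z (he2 (τ z)), hregT he3, ?_, ?_, ?_⟩
  · rintro _ ⟨z, hz, rfl⟩
    have hz' : τ z ∈ (𝓔.support : Set X) := by rw [support_comap] at hz; exact hz
    rw [Scheme.Hom.comp_apply]
    exact he4 ⟨τ z, hz', rfl⟩
  · exact hRuled G G' γ E X X'' σ jG j₂ t₂ 𝓔 τ υ₂ pt hcomm hsq₂ hyE ⟨e𝓔, he𝓔⟩ he5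
  · -- the cone shadow with the LOCALIZED trace; the cone may meet the centre
    rcases hK with hK0 | hyK
    · left
      rw [hK0, Set.empty_sdiff, Set.preimage_empty, closure_empty]
    rcases hSh with hK0 | ⟨𝒦, hk1, ⟨V, hEV, hk2⟩, hk3, hk4, hk5, hk6⟩
    · left
      rw [hK0, Set.empty_sdiff, Set.preimage_empty, closure_empty]
    refine Or.inr ⟨𝒦.comap τ, fun z => isPrincipal_stalkIdeal_comap τ 𝒦 z (hk1 (τ z)), ⟨υ₂ ⁻¹ᵁ V, ?_, ?_⟩, ?_, ?_, ?_, ?_⟩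
    · -- `E′ ⊆ υ₂⁻¹V`
      exact hE'sub.trans (Set.preimage_mono hEV)
    · -- (k-ii-loc) on `υ₂⁻¹V`
      rw [comap_comap_comap_ι_eq_of_loc hcomm hυ₂ hD 𝒦 K V hk2 hyK]
      congr 2
      exact Closeds.ext closure_closure.symm
    · -- (k-iii) flatness through the iso over `τ` (the pair lies inside `V(𝓔)`, which misses the centre)
      rw [← Scheme.IdealSheafData.comap_sup]
      have hdEK : Disjoint (((𝓔 ⊔ 𝒦).support : Set X)) (C.support : Set X) :=
        hd𝓔.mono_left (Scheme.IdealSheafData.support_antitone (le_sup_left : 𝓔 ≤ 𝓔 ⊔ 𝒦))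
      obtain ⟨e', he'⟩ := exists_iso_subscheme_comap_of_disjoint hτ (𝓔 ⊔ 𝒦) hdEK
      have hfac : ((𝓔 ⊔ 𝒦).comap τ).subschemeι ≫ (τ ≫ σ) ≫ q = e'.hom ≫ ((𝓔 ⊔ 𝒦).subschemeι ≫ σ ≫ q) := by
        rw [← Category.assoc e'.hom, he', Category.assoc, Category.assoc]
      rw [hfac]
      haveI := hk3
      infer_instance
    · -- (k-iv) conditional regularity, localized trace
      exact Tower.shadow_conditionalRegularity_transport_loc hτ hcomm hυ₂ hD 𝓔 𝒦 hd𝓔 hEcl hyE hyK he1 hEV hk2 hk4 hE'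
    · -- (k-v) by locality
      exact isEffectiveCartier_comap_comap_subschemeι_of_disjoint_left hτ 𝓔 𝒦 hd𝓔 he2 hk1 hk5
    · -- (k-vi) the cone cuts a Cartier divisor on `V(𝓔)`, through `V(𝓔.comap τ) ≅ V(𝓔)`
      have h1 : (𝒦.comap τ).comap (𝓔.comap τ).subschemeι = (𝒦.comap 𝓔.subschemeι).comap e𝓔.hom := by
        rw [← Scheme.IdealSheafData.comap_comp, ← Scheme.IdealSheafData.comap_comp, he𝓔]
      rw [h1]
      exact hk6.comap_of_isOpenImmersion e𝓔.hom

include hTirr hEcl hTE hExc hdisj hcomm hτ in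
/-- **A point step on `Tower.Inv₃`, TRANSPORTED SURFACE, SHADOW FORGOTTEN** (`K ↦ ∅`, γ-forget). [cite: GortzWedhorn2020, Prop. 13.91 (3)]
[OURS · L1 W4.5b · (R-a)] toward `stub_elnat_coneTowerPointResolution`; NOT a statement of the manuscript. -/
theorem Tower.inv₃_pointCentre_forget
    (hRuled : ∀ (G₀ G₀' : Scheme.{0}) (γ₀ : G₀ ⟶ F₁₀) (E₀ : Set G₀) (X₀ X₀'' : Scheme.{0}) (σ₀ : X₀ ⟶ P) (j₀ : G₀ ⟶ X₀)
        (j₀' : G₀' ⟶ X₀'') (t₀' : G₀' ⟶ Spec (.of k)) (𝓔₀ : X₀.IdealSheafData) (τ₀ : X₀'' ⟶ X₀) (υ₀ : G₀' ⟶ G₀) (y₀ : G₀),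
      j₀' ≫ τ₀ = υ₀ ≫ j₀ → IsPullback j₀' t₀' ((τ₀ ≫ σ₀) ≫ q) (Spec.map (CommRingCat.ofHom θ)) → y₀ ∉ E₀ →
      (∃ e : (𝓔₀.comap τ₀).subscheme ≅ 𝓔₀.subscheme, e.hom ≫ 𝓔₀.subschemeι = (𝓔₀.comap τ₀).subschemeι ≫ τ₀) →
      Ruled F₉ Z₉ hZ₉ F₁₀ υ' G₀ γ₀ E₀ X₀ σ₀ j₀ 𝓔₀ →
      Ruled F₉ Z₉ hZ₉ F₁₀ υ' G₀' (υ₀ ≫ γ₀) (closure (υ₀ ⁻¹' (E₀ \ {y₀}))) X₀'' (τ₀ ≫ σ₀) j₀' (𝓔₀.comap τ₀))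
    (hE : Tower.NoRound υ' G γ E ∨ pt ∉ E) :
    Tower.Inv₃ O k θ P q Y Ch Ruled F₉ Z₉ hZ₉ F₁₀ υ' G' (υ₂ ≫ γ) (closure (υ₂ ⁻¹' (T \ {pt})))
      (closure (υ₂ ⁻¹' (E \ {pt}))) ∅ := by
  -- forget the shadow in the old datum, then transport with `K := ∅`
  have hExc' : ∀ hE : IsClosed E, Tower.Exc₃ O P q Y Ruled Z₉ hZ₉ υ' G γ E hE (∅ : Set G) X σ jG := by
    intro hE'
    rcases hExc hE' with hno | ⟨𝓔, he1, he2, he3, he4, he5, -⟩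
    · exact Or.inl hno
    · exact Or.inr ⟨𝓔, he1, he2, he3, he4, he5, Or.inl rfl⟩
  have h := Tower.inv₃_pointCentre_transport O k θ P q Y Ch Ruled hυ' hZ₉inf hTirr hEcl hTE hExc' hyc hTy hD hυ₂ hτ hdisj hcomm
    hCh'' hX''reg hdom'' hsq₂ hsets hT'irr hRuled hE (Or.inl rfl)
  simpa only [Set.empty_sdiff, Set.preimage_empty, closure_empty] using h

end PointCentre

end Summit.ResolutionOfSingularities.ResolutionOfSingularities.Cruxes.EquisingularLiftNat.Sections

end
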